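import Literature.AnabelianGeometry.SemiGraphs.PSCIrreducibleMultiNodalOrigin
import Literature.AnabelianGeometry.SemiGraphs.PSCSeparatingCoveringsLevelEdges
import HarnessLib

/-!
# A PSC datum of TWO-NODE-CYCLE shape over every pro-`Σ` completion of `Γ_{g,r}` (consistency of the shape hypotheses)

Mochizuki, *A combinatorial version of the Grothendieck conjecture*, Tohoku Math. J. **59** (2007)
[CombGC], Def. 1.1 (i) p. 6 [cite: MochizukiCombGC2007, Def 1.1(i) p.6].  PROOF-ONLY (abc-iut-f-164
gen 5, NEXT-SHAPES row «TWO-NODE-CYCLE»): the shape hypotheses of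
`PSCSeparatingCoveringsTwoNodeCycle.lean` / `…Edges.lean` — two components `v₀` (genus `m`, cusps
`c_s,…,c_{r-1}`) and `v₁` (genus `g-m-1`, cusps `c_0,…,c_{s-1}`) joined by TWO nodes with groups the
closures of `⟨b_m⟩` and `⟨δ⟩`, `δ = (c_0⋯c_{s-1})⁻¹([a_{m+1},b_{m+1}]⋯[a_{g-1},b_{g-1}])⁻¹ b_m`, the
first dual graph with a CYCLE — are CONSISTENT: `exists_twoNodeCycleDatum` builds such a `PSCDatum`
(`i = n = 2`) over any pro-`Σ` completion `ι : Γ_{g,r} → Π` (the `a_m⁻¹(·)a_m`-conjugate branch of the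
node `⟨b_m⟩` lands in `Π_{v₀} ∋ a_m b_m a_m⁻¹`).  Consistency evidence for the typed rows at data of the
shape of genuine curves; nothing here takes a side on [IUTchIII] Cor. 3.12.
-/

noncomputable section

namespace Literature.AnabelianGeometry.SemiGraphs

open scoped Pointwise
open Literature.GroupTheory.CombinatorialGroupTheory
open SemiGraphOfAnabelioids (IsProSigmaCompletion)

namespace PSCDatum

/-- **A PSC datum of two-node-cycle shape exists over every pro-`Σ` completion of `Γ_{g,r}`**
(`m + 2 ≤ g`, `1 ≤ s`, `s + 1 ≤ r`): vertices `v₀ ≠ v₁` of genera `m`, `g - m - 1`, two nodes with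
groups the closures of `⟨b_m⟩`, `⟨δ⟩`, cusps `c_j` on `v₁` for `j < s` and on `v₀` otherwise.
[cite: MochizukiCombGC2007, Def 1.1(i) p.6] -/
theorem exists_twoNodeCycleDatum (Sigma : Set ℕ) (hne : Sigma.Nonempty)
    (hprime : ∀ p ∈ Sigma, p.Prime) (g r m s : ℕ) (hm : m + 2 ≤ g) :
    ∃ (Q : ProfiniteGrp.{0}) (ι : PuncturedSurfaceGroup g r →* Q) (G : PSCDatum Q)
      (e : G.graph.C ≃ Fin r) (v₀ v₁ : G.graph.V) (n₁ n₂ : G.graph.N),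
      IsProSigmaCompletion Sigma ι ∧ G.Sigma = Sigma ∧ G.graph.i = 2 ∧ G.graph.n = 2 ∧ G.graph.r = r ∧
      (∀ c, G.cuspGp c =
        ((PuncturedSurfaceGroup.cuspInertia (g := g) (e c)).map ι).topologicalClosure) ∧
      (∀ w, w = v₀ ∨ w = v₁) ∧ (∀ n, n = n₁ ∨ n = n₂) ∧
      G.vertGp v₀ = ((Subgroup.closure {x : PuncturedSurfaceGroup g r |
        (∃ i : Fin g, (i : ℕ) < m ∧ (x = PuncturedSurfaceGroup.a i ∨ x = PuncturedSurfaceGroup.b i)) ∨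
        (∃ j : Fin r, s ≤ (j : ℕ) ∧ x = PuncturedSurfaceGroup.c j) ∨
        x = PuncturedSurfaceGroup.a ⟨m, by omega⟩ * PuncturedSurfaceGroup.b ⟨m, by omega⟩ *
          (PuncturedSurfaceGroup.a ⟨m, by omega⟩)⁻¹ ∨
        x = (((List.finRange r).map fun j : Fin r =>
            if (j : ℕ) < s then PuncturedSurfaceGroup.c (g := g) j else 1).prod)⁻¹ *
          (((List.finRange g).map fun i : Fin g => if m + 1 ≤ (i : ℕ) then
            PuncturedSurfaceGroup.a (r := r) i * PuncturedSurfaceGroup.b i *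
              (PuncturedSurfaceGroup.a i)⁻¹ * (PuncturedSurfaceGroup.b i)⁻¹ else 1).prod)⁻¹ *
          PuncturedSurfaceGroup.b ⟨m, by omega⟩}).map ι).topologicalClosure ∧
      G.vertGp v₁ = ((Subgroup.closure {x : PuncturedSurfaceGroup g r |
        (∃ i : Fin g, m < (i : ℕ) ∧ (x = PuncturedSurfaceGroup.a i ∨ x = PuncturedSurfaceGroup.b i)) ∨
        (∃ j : Fin r, (j : ℕ) < s ∧ x = PuncturedSurfaceGroup.c j) ∨
        x = PuncturedSurfaceGroup.b ⟨m, by omega⟩ ∨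
        x = (((List.finRange r).map fun j : Fin r =>
            if (j : ℕ) < s then PuncturedSurfaceGroup.c (g := g) j else 1).prod)⁻¹ *
          (((List.finRange g).map fun i : Fin g => if m + 1 ≤ (i : ℕ) then
            PuncturedSurfaceGroup.a (r := r) i * PuncturedSurfaceGroup.b i *
              (PuncturedSurfaceGroup.a i)⁻¹ * (PuncturedSurfaceGroup.b i)⁻¹ else 1).prod)⁻¹ *
          PuncturedSurfaceGroup.b ⟨m, by omega⟩}).map ι).topologicalClosure ∧
      G.nodeGp n₁ = ((Subgroup.zpowers (PuncturedSurfaceGroup.b (r := r) ⟨m, by omega⟩)).map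
        ι).topologicalClosure ∧
      G.nodeGp n₂ = ((Subgroup.zpowers ((((List.finRange r).map fun j : Fin r =>
            if (j : ℕ) < s then PuncturedSurfaceGroup.c (g := g) j else 1).prod)⁻¹ *
          (((List.finRange g).map fun i : Fin g => if m + 1 ≤ (i : ℕ) then
            PuncturedSurfaceGroup.a (r := r) i * PuncturedSurfaceGroup.b i *
              (PuncturedSurfaceGroup.a i)⁻¹ * (PuncturedSurfaceGroup.b i)⁻¹ else 1).prod)⁻¹ *
          PuncturedSurfaceGroup.b ⟨m, by omega⟩)).map ι).topologicalClosure ∧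
      G.genus v₀ = m ∧ G.genus v₁ = g - m - 1 ∧ (∀ n, G.graph.nodeEnds n = s(v₀, v₁)) := by
  classical
  obtain ⟨Q, ι, hι⟩ :=
    IsProSigmaCompletion.exists_isProSigmaCompletion (PuncturedSurfaceGroup g r) Sigma
  set km : Fin g := ⟨m, by omega⟩ with hkm
  set δ : PuncturedSurfaceGroup g r := (((List.finRange r).map fun j : Fin r =>
      if (j : ℕ) < s then PuncturedSurfaceGroup.c (g := g) j else 1).prod)⁻¹ *
    (((List.finRange g).map fun i : Fin g => if m + 1 ≤ (i : ℕ) then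
      PuncturedSurfaceGroup.a (r := r) i * PuncturedSurfaceGroup.b i *
        (PuncturedSurfaceGroup.a i)⁻¹ * (PuncturedSurfaceGroup.b i)⁻¹ else 1).prod)⁻¹ *
    PuncturedSurfaceGroup.b km with hδ
  let S₀ : Set (PuncturedSurfaceGroup g r) := {x |
    (∃ i : Fin g, (i : ℕ) < m ∧ (x = PuncturedSurfaceGroup.a i ∨ x = PuncturedSurfaceGroup.b i)) ∨
    (∃ j : Fin r, s ≤ (j : ℕ) ∧ x = PuncturedSurfaceGroup.c j) ∨
    x = PuncturedSurfaceGroup.a km * PuncturedSurfaceGroup.b km * (PuncturedSurfaceGroup.a km)⁻¹ ∨ x = δ}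
  let S₁ : Set (PuncturedSurfaceGroup g r) := {x |
    (∃ i : Fin g, m < (i : ℕ) ∧ (x = PuncturedSurfaceGroup.a i ∨ x = PuncturedSurfaceGroup.b i)) ∨
    (∃ j : Fin r, (j : ℕ) < s ∧ x = PuncturedSurfaceGroup.c j) ∨
    x = PuncturedSurfaceGroup.b km ∨ x = δ}
  let A₀ : Subgroup Q := ((Subgroup.closure S₀).map ι).topologicalClosure
  let A₁ : Subgroup Q := ((Subgroup.closure S₁).map ι).topologicalClosure
  let Eb : Subgroup Q := ((Subgroup.zpowers (PuncturedSurfaceGroup.b (r := r) km)).map ι).topologicalClosure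
  let Eδ : Subgroup Q := ((Subgroup.zpowers δ).map ι).topologicalClosure
  have hle : ∀ (S : Set (PuncturedSurfaceGroup g r)) (x : PuncturedSurfaceGroup g r), x ∈ S →
      ((Subgroup.zpowers x).map ι).topologicalClosure ≤ ((Subgroup.closure S).map ι).topologicalClosure :=
    fun S x hx => Subgroup.topologicalClosure_mono (Subgroup.map_mono ((Subgroup.zpowers_le).mpr
      (Subgroup.subset_closure hx)))
  have hb₀ : ConjAct.toConjAct (ι (PuncturedSurfaceGroup.a km)) • Eb ≤ A₀ := by
    change ConjAct.toConjAct (ι (PuncturedSurfaceGroup.a km)) •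
      ((Subgroup.zpowers (PuncturedSurfaceGroup.b (r := r) km)).map ι).topologicalClosure ≤ _
    rw [toConjAct_smul_topologicalClosure_map_zpowers]
    exact hle S₀ _ (Or.inr (Or.inr (Or.inl rfl)))
  have hb₁ : Eb ≤ A₁ := hle S₁ _ (Or.inr (Or.inr (Or.inl rfl)))
  have hδ₀ : Eδ ≤ A₀ := hle S₀ _ (Or.inr (Or.inr (Or.inr rfl)))
  have hδ₁ : Eδ ≤ A₁ := hle S₁ _ (Or.inr (Or.inr (Or.inr rfl)))
  let T : PSCDatum Q :=
    { Sigma := Sigma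
      sigma_prime := hprime
      sigma_nonempty := hne
      graph := { V := Bool, N := Bool, C := Fin r, nodeEnds := fun _ => s(false, true),
                 cuspEnd := fun j => decide ((j : ℕ) < s) }
      vertGp := fun v => cond v A₁ A₀
      nodeGp := fun n => cond n Eδ Eb
      cuspGp := fun j => ((PuncturedSurfaceGroup.cuspInertia (g := g) j).map ι).topologicalClosure
      genus := fun v => cond v (g - m - 1) m
      isClosed_vertGp := fun v => by cases v <;> exact Subgroup.isClosed_topologicalClosure _
      isClosed_nodeGp := fun n => by cases n <;> exact Subgroup.isClosed_topologicalClosure _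
      isClosed_cuspGp := fun _ => Subgroup.isClosed_topologicalClosure _
      nodeGp_le := fun n => by
        cases n
        · exact ⟨false, true, rfl, ⟨ConjAct.toConjAct (ι (PuncturedSurfaceGroup.a km)), hb₀⟩,
            ⟨1, by rw [one_smul]; exact hb₁⟩⟩
        · exact ⟨false, true, rfl, ⟨1, by rw [one_smul]; exact hδ₀⟩, ⟨1, by rw [one_smul]; exact hδ₁⟩⟩
      cuspGp_le := fun j => ⟨1, by
        rw [one_smul]
        change _ ≤ cond (decide ((j : ℕ) < s)) A₁ A₀
        by_cases hj : (j : ℕ) < s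
        · rw [decide_eq_true hj]
          exact hle S₁ _ (Or.inr (Or.inl ⟨j, hj, rfl⟩))
        · rw [decide_eq_false hj]
          exact hle S₀ _ (Or.inr (Or.inl ⟨j, not_lt.mp hj, rfl⟩))⟩
      proSigma := isProSigma_of_isProSigmaCompletion hι }
  refine ⟨Q, ι, T, Equiv.refl _, false, true, false, true, hι, rfl, Fintype.card_bool, Fintype.card_bool,
    Fintype.card_fin r, fun _ => rfl, fun w => ?_, fun n => ?_, rfl, rfl, rfl, rfl, rfl, rfl, fun _ => rfl⟩
  · cases w
    · exact Or.inl rfl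
    · exact Or.inr rfl
  · cases n
    · exact Or.inl rfl
    · exact Or.inr rfl

end PSCDatum

end Literature.AnabelianGeometry.SemiGraphs

end
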